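import Summits.HubbardSuperconductivity.HubbardSuperconductivity.Theses.CooperPairDMottWalk
import Summits.HubbardSuperconductivity.HubbardSuperconductivity.Theorems.CooperPairDMottWalkCooperPairDMottPlaquettePairBinding
import Summits.HubbardSuperconductivity.HubbardSuperconductivity.Theorems.CooperPairDMottWalkCooperPairDMottPairTrialCeiling
import Summits.HubbardSuperconductivity.HubbardSuperconductivity.Theorems.CooperPairDMottWalkCooperPairDMottUniqueTwoHoleGroundState
import Summits.HubbardSuperconductivity.HubbardSuperconductivity.Theorems.CooperPairDMottWalkCooperPairDMottDWaveResidue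
import Summits.HubbardSuperconductivity.HubbardSuperconductivity.Theorems.CooperPairDMottWalkCooperPairDMottPlaquetteGCWindow
import Summits.HubbardSuperconductivity.HubbardSuperconductivity.Theorems.CooperPairDMottWalkCooperPairDMottPlaquetteDWaveElement
import Summits.HubbardSuperconductivity.HubbardSuperconductivity.Theorems.CooperPairDMottWalkCooperPairDMottTwoHoleGap
import Summits.HubbardSuperconductivity.HubbardSuperconductivity.Theorems.CooperPairDMottWalkCooperPairDMottDWaveResidueStructural
import Summits.HubbardSuperconductivity.HubbardSuperconductivity.Theorems.CooperPairDMottWalkCooperPairDMottHolonBandFloor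
import Summits.HubbardSuperconductivity.HubbardSuperconductivity.Theorems.CooperPairDMottWalkCooperPairDMottPlaquetteOddSectorFloor

/-!
# Crux `CooperPairDMott` (stmt-HubbardSuperconductivity-1177) — birth skeleton `Lines/birth.lean` (BC3)

Route `CooperPairDMottWalk` (route-HubbardSuperconductivity-CooperPairDMottWalk) of
`HubbardSuperconductivity/HubbardSuperconductivity`, crux of rank 3
(`Summit.HubbardSuperconductivity.HubbardSuperconductivity.Theses.CooperPairDMottWalk.CooperPairDMott`),
the COOPER THEOREM IN THE d-MOTT INSULATOR: for every `U ∈ [2, 4]` there is `b₀ > 0` such that for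
all inter-plaquette hoppings `b ∈ (0, b₀)` the breathing torus `H_L(1, b, U)` (`Hb L 1 b U`: hopping
`1` and repulsion `U` on the bonds inside the `2 × 2` plaquettes `{2m, 2m+1}²`, hopping `b` on the
other nearest-neighbour bonds), `L = 4k + 4` large, has
 (a) PAIR BINDING `E(L²−2, 0) + E(L², 0) + ε ≤ 2·E(L²−1, ½)` with `ε > 0`
     (`E(N, M) = (Hb L 1 b U).minEnergyOn (szSector N M)`),
 (b) a UNIQUE ground state of the two-hole sector `(L²−2, S^z = 0)`,
 (c) a MACROSCOPIC `d_{x²−y²}` AMPLITUDE `z·L²·‖φ₀‖²‖φ₂‖² ≤ |⟨φ₂, Δ_d φ₀⟩|²`, `z > 0`, for all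
     sector ground states `φ₀` (half filling) and `φ₂` (two holes), `Δ_d = pairField dWaveFormFactor L`,
with `ε, z, k₀` allowed to depend on `(U, b)` — verbatim the route decl (the `let CP …; let Hb …` body).

## The line (the route's own proof sketch, typed): plaquette data + two L-uniform threshold
## estimates + the pair band

At `b = 0` the torus is `(L/2)²` decoupled Hubbard plaquettes (= the `2 × 2` torus
`hubbardTorus 2 2 1 U`, the 4-cycle with hopping `1`), with sector energies
`e_N^M(U) = (hubbardTorus 2 2 1 U).minEnergyOn (szSector N M)`; the half-filled parent is the
product of the unique plaquette singlets (`e₄⁰`), one hole costs `e₃^½ − e₄⁰`, the one-plaquette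
pair costs `e₂⁰ − e₄⁰`, and the plaquette pair-binding energy is
`Δ_p(U) = 2e₃^½ − e₂⁰ − e₄⁰ > 0` on `0 < U < U_c ≈ 4.58` [TsaiKivelson2006; refuter ED kit job
j000082: `Δ_p = 0.017 – 0.039` on `U ∈ [2, 4]`]. Clause (a) is the statement that this O(1)
budget survives the inter-plaquette hopping UNIFORMLY IN THE VOLUME although every absolute energy
moves by `O(b²L²)`: the two thresholds below isolate exactly the two L-uniform RELATIVE estimates
that carry it (locality of few-hole excitation energies over the gapped d-Mott parent — the
convergent-expansion / quasi-particle engines DattaFernandezFrohlich1999, Yarotsky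
doi:10.1007/s00220-005-1456-9 and arXiv:math-ph/0411042, fermionic gap stability
Koma2020GapStability / arXiv:1712.00977 / arXiv:1705.08553), and the skeleton theorem does the
budget arithmetic `ε = Δ_p(U) − (2C_H + C_P)·b > 0` for `b < b₀ := min(b_H, b_P, b_U, b_D,
Δ_p/(2C_H + C_P))`, `k₀ := max` of the four onsets.

* `stub_plaquettePairBinding` (Δ — zeroth order, certified computation): `e₂⁰ + e₄⁰ < 2e₃^½` for
  every `U ∈ [2, 4]`. Verbatim clause 1 of the route's support item `PlaquettePairBinding`
  (stmt-HubbardSuperconductivity-1181, a 256-dimensional certified ED being built in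
  `Theorems/CooperPairDMottWalkPlaquette*.lean`); closes by `fun U hU => (h U hU).1` once that
  item lands. Why it might fail: it cannot on `[2, 4] ⊂ (0, 4.58)` unless the certified table
  contradicts Tsai–Kivelson (j000082 agrees). Size M.
* `stub_holonBandFloor` (H — the one-hole threshold from BELOW, uniform in `L`): for every
  `U ∈ [2, 4]` there are `C > 0`, `b₀ > 0` with `E(L², 0) + (e₃^½ − e₄⁰) − C·b ≤ E(L²−1, ½)` for all
  `b ∈ (0, b₀)` and all large `L = 4k+4`: removing one electron from the d-Mott parent costs at
  least the plaquette holon energy minus the `O(b)` holon half-bandwidth (first-order degenerate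
  perturbation theory of the `(L/2)²`-fold holon level; the `O(b²L²)` vacuum shifts of the two
  sectors cancel up to `O(b²)`). This is the TWO-HOLON CONTINUUM EDGE of the Feshbach picture, used
  twice in (a). Why plausibly true: quasi-particle band of a weakly coupled block system
  (arXiv:math-ph/0411042, DattaFernandezFrohlich1999) over a parent whose gap is stable
  (Koma2020GapStability; in tree: `michalakis_zwolak`); why it might fail as a THEOREM: the
  fermionic (Jordan–Wigner-even) version of the block quasi-particle construction with an
  `L`-uniform `O(b)` remainder is not in print; the parent's own gap must first be controlled at
  the same `b`. Size L.
* `stub_pairTrialCeiling` (P — the two-hole level from ABOVE, uniform in `L`): for every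
  `U ∈ [2, 4]` there are `C > 0`, `b₀ > 0` with `E(L²−2, 0) ≤ E(L², 0) + (e₂⁰ − e₄⁰) + C·b`: the
  dressed parent with ONE plaquette put into its two-electron ground state is a trial state whose
  excess energy over the parent is the bare pair cost up to a LOCAL `O(b)` (indeed `O(b²)`)
  correction — "local perturbations perturb locally" for the convergent expansion of the parent.
  Why it might fail as a THEOREM: needs the parent's expansion (or LPPL + spectral flow) in the
  fermionic setting with constants uniform in `L`; none vendored. Size M–L.
* `stub_uniqueTwoHoleGroundState` (U — clause (b), the pair band has a non-degenerate bottom):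
  for every `U ∈ [2, 4]`, small `b` and large `L`, the `(L²−2, S^z=0)` ground state of `H_L(1,b,U)`
  is unique up to a scalar. Content: Feshbach–Schur reduction of the two-hole sector below the
  two-holon edge onto the `(L/2)²` one-plaquette `B₁g` pair states; the effective pair hopping
  `t_pair = c(U)·b²` splits them into a band on the plaquette torus of EVEN side `L/2 = 2k+2`, whose
  bottom (at `K = 0` for the sign found in j000082, at `(π,π)` for the other sign — non-degenerate
  either way on an even torus) is simple, and two-holon / triplet states sit `≥ Δ_p − O(b)` higher.
  Why it might fail: `c(U) = 0` for some `U ∈ [2, 4]` (degeneracy lifted only at `O(b³)`, no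
  control), or an `s`-wave / finite-momentum intruder level within `O(b²)` of the bottom
  (kill criterion (ii) of the route). Size L.
* `stub_dWaveResidueOfUniquePair` (D — clause (c) GIVEN (b)): for every `U ∈ [2, 4]`, small `b`,
  some `z > 0` and large `L`: IF the two-hole ground state is unique up to a scalar, THEN every pair
  (`φ₀` parent ground state, `φ₂` two-hole ground state) has `z·L²·‖φ₀‖²‖φ₂‖² ≤ |⟨φ₂, Δ_d φ₀⟩|²`.
  Content: the unique `φ₂` is the ZERO-MOMENTUM superposition `(L/2)⁻¹ Σ_p |pair at p⟩` dressed at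
  `O(b)`, so `⟨φ₂, Δ_d φ₀⟩ ≈ (L/2)·m_d(U)` with `m_d ≠ 0` the plaquette `d`-wave matrix element
  (clause 4 of `PlaquettePairBinding`; Scalapino–Trugman doi:10.1080/01418639608240361), i.e.
  `z = |m_d|²/4 − O(b)` in the plaquette normalisation. Stated conditionally on (b) so that it does
  not silently contain (b) (for a degenerate two-hole level (c) is false for SOME ground state).
  Why it might fail: pair momentum `(π,π)` instead of `0` (then `⟨φ₂, Δ_d φ₀⟩ = 0` exactly — kill
  criterion (ii); j000082 finds `K = 0` on the 2×4 two-plaquette cluster), or `m_d(U) = 0`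
  somewhere on `[2, 4]`. Size L.
* `CooperPairDMott_of : Δ → H → P → U → D → CooperPairDMott` — PROVED (no `sorry`; axioms
  propext / Classical.choice / Quot.sound), concluding the crux BY NAME: fix `U`; take
  `(C_H, b_H)`, `(C_P, b_P)`, `b_U`, `b_D` from the stubs and `Δ_p(U) > 0` from Δ; put
  `b₀ := min (min (min b_H b_P) (min b_U b_D)) (Δ_p / (2C_H + C_P)) > 0`; for `b ∈ (0, b₀)` the
  budget `(2C_H + C_P)·b < Δ_p` holds (`lt_div_iff₀`), so `ε := Δ_p − (2C_H + C_P)·b > 0`; take the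
  four onsets `k_H, k_P, k_U, (z, k_D)` at this `b` and `k₀ := max (max k_H k_P) (max k_U k_D)`; for
  `k ≥ k₀` clause (a) is `linarith` from H (coefficient 2), P and the definition of `Δ_p`, clause
  (b) is U, clause (c) is D fed with U. About 60 lines; the only mathematics is the threshold
  bookkeeping `2·(holon floor) − (pair ceiling) ≥ Δ_p − (2C_H + C_P)·b`, which is exactly how the
  cluster literature's `Δ_pb = 2E(N−1) − E(N) − E(N−2)` decomposes.
* `CooperPairDMott_of_stubs : CooperPairDMott` — the same, hypothesis-free, from the five named
  stubs (its only `sorry`s are inside `stub_*`, one each).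

BC3 probes (planner folder `bc/`, 2026-08-17; files `stub_<name>_probe.lean`, `…_probeC.lean`,
raw JSON kept): for each stub `S ∈ {Δ, H, P, U, D}` —
 `S → CooperPairDMott` by EACH of `exact?` · `simpa` · `simpa [CooperPairDMott]` ·
 `(unfold CooperPairDMott; simpa)` · `aesop` (one example per tactic, `maxHeartbeats 400000`):
 25/25 FAIL (`exact?`: deterministic timeout at `whnf` within the budget; the three `simpa`s:
 "Tactic `assumption` failed"; `aesop`: "failed to prove the goal after exhaustive search");
 `S → HubbardSuperconductivity` by `first | exact? | simpa | simpa [HubbardSuperconductivity,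
 DWaveSuperconductivityHubbard] | aesop`: 5/5 FAIL (all alternatives ran: unsolved goal
 `⊢ HubbardSuperconductivity`, aesop exhaustive search failed). No stub is cheaply the crux or
 the summit: Δ is a 4-site statement, H and P are one-sided energy inequalities with no
 uniqueness / amplitude content, U lacks (a) and (c), D is conditional and lacks (a), (b).
Disproof used: none filed for this crux (`ledger crux ls stmt-HubbardSuperconductivity-1177`:
no workfiles at registration; no `Theorems/CooperPairDMott/Negative/`). Negatives index
(`ledger negatives --problem HubbardSuperconductivity`, 2 entries): the all-even-`L` breathing
self-duality `BreathingSelfDual` (witness `L = 2`; this skeleton only ever uses `L = 4k+4 ≥ 4` and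
no self-duality) and the AposterioriCapRg KLS-openness statement (unrelated). Evidence read:
compute-j000082.json on the item (plaquette / two-plaquette ED: `Δ_p(U) ∈ [0.017, 0.039]` on
`[2,4]`, `t_pair ∝ −b²` ⇒ `K = 0`).
Sources: TsaiKivelson2006; YaoTsaiKivelson2007; arXiv:0803.0933 (eq. (2): `Δ_pb`);
doi:10.1080/01418639608240361; DattaFernandezFrohlich1999; doi:10.1007/s00220-005-1456-9;
arXiv:math-ph/0411042; Koma2020GapStability; arXiv:1712.00977; arXiv:1705.08553;
doi:10.1007/s00220-013-1688-z (two-particle bound-state template); LiebPRL1989.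
-/

/-!
## Reshape 1 (lead, 2026-08-17, after wave 1)

* Δ `stub_plaquettePairBinding` — LANDED (certified 24-dim Gram/LDLᵀ kernel computation on a
  U-grid + endpoint margins): `Theorems.CooperPairDMottWalk.stub_plaquettePairBinding` (p150817).
* P `stub_pairTrialCeiling` — PROVED MODULO ONE PLAQUETTE DATUM by the elementary best-plaquette
  trial-state argument (`pairTrialCeiling_of_plaquetteGCWindow`, p152016 + 10 helper files): the new
  stub `stub_plaquetteGCWindow` is that datum (grand-canonical stability window of the 4-electron
  plaquette state: `∃ μ γ>0, h − μN ≥ e₄ − 4μ + γ` off the `(4,0)` ground space; numerically true with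
  μ = U/2, γ = 0.14–0.30 on [2,4]; reducible to sector-wise certified bounds by
  `pairTrialCeiling_windowReduction`). P is no longer a stub.
* U `stub_uniqueTwoHoleGroundState` — reduced VERBATIM (`uniqueTwoHoleGroundState_of_gap_orthogonal`,
  p149865) to the new stub `stub_twoHoleGapOrthogonal`: a vector Ω and a level E₁ > E(L²−2,0) bounding
  the form of `Hb` from below on Ω^⊥ ∩ sector — exactly the output the (missing) flat-band engine must
  produce. No symmetry forces a degeneracy (wave-1 analysis: odd orders vanish on the pair manifold by
  the checkerboard colouring of plaquettes, E(K) = h₀ + 2h₁(cos Kx + cos Ky) + O(b⁴)).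
* D `stub_dWaveResidueOfUniquePair` — reduced VERBATIM (`dWaveResidueOfUniquePair_of_exists`, p152712,
  using Lieb's theorem for two hoppings ⇒ the parent is ONE ray for b ≠ 0, and homogeneity) to the new
  stub `stub_dWaveResidueExists`: ONE good pair (φ₀, φ₂) suffices.
* H `stub_holonBandFloor` — unchanged (lead): ⟺ Mott-gap stability of the half-filled breathing
  torus; needs relative-bound gap stability for fermionic interacting block parents (engine not in
  print; see NOTES.md of the lead).
Open stubs: `stub_plaquetteGCWindow` (certified computation, M), `stub_holonBandFloor` (L),
`stub_twoHoleGapOrthogonal` (L), `stub_dWaveResidueExists` (L). The composition is unchanged.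

## Reshape 2 (lead, same day, before wave 2)

D′ split into its certified-computation leaf and its structural part (glue = application):
`stub_plaquetteDWaveElement` (D′a: clauses 2 and 4 of PlaquettePairBinding — unique `(2,0)` plaquette
ground state, nonzero `d`-wave matrix element; M) and `stub_dWaveResidueStructural` (D′b: D′a → GCW →
D′; L, engine-level). Open stubs: GCW, H, U′, D′a, D′b (5 ≤ 7).

## Reshape 3 (lead, after wave 2)

* GCW LANDED (p156227, μ = U/2, γ = 1/20, certified) ⇒ P `pairTrialCeiling` is CLOSED (sorry-free cone).
* D′a LANDED (p156482, certified).
* U′ reduced verbatim by Feshbach–Schur + plaquette-momentum blocks (`twoHoleGapOrthogonal_of_pairBandSchur`,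
  p156161, helpers p154646 p155167 p155728) to the new stub `stub_pairBandSchur` (U″: E0/E1/E2 per momentum).
* D′b reduced verbatim (`dWaveResidueStructural_of_pairStructure`, p155593, helpers p154627 p155301 p155808) to
  the new stubs `stub_pairOverlapStructure` (S1) and `stub_pairRemainderLocality` (S3).
Open stubs: H (lead), U″, S1, S3 — ALL engine-level (relative-bound gap stability for fermionic block parents;
flat-band second-order perturbation theory with locality; clustering/LPPL of the dressed states). Everything
finite-dimensional / certified / bookkeeping has landed.

## Reshape 4 (lead, cycle 3): H split into its engine and its plaquette datum

`stub_holonBandFloor` ⟸ `stub_relativeBoundDMott` (RB, the engine: Bravyi–Hastings–Michalakis relative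
boundedness for the fermionic plaquette parent, stated with an abstract number-conserving isometry) +
`stub_plaquetteOddSectorFloor` (OF, certified plaquette datum at μ = U/2) through the landed glue
`holonBandFloor_of_relativeBound` (p157906) and parity bookkeeping (p157664). Open stubs: RB, OF, U″, S1, S3;
OF is a finite computation, the other four are engine-level (RB ∋ E1 of U″).
OF LANDED in wave 3 (p159090). Open stubs after cycle 3: RB, U″, S1, S3 — engine-level only.
-/

set_option linter.dupNamespace false

namespace Summit.HubbardSuperconductivity.HubbardSuperconductivity.Cruxes.CooperPairDMott.Birth

open scoped BigOperators Topology Manifold Classical MeasureTheory ProbabilityTheory Matrix InnerProductSpace ComplexConjugate ContinuousMap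
open Filter Set Function TopologicalSpace MeasureTheory
open Literature.Hubbard
open Literature.MathematicalPhysics.QuantumLattice
open Summit.HubbardSuperconductivity.HubbardSuperconductivity.Theses.CooperPairDMottWalk

/-! ## The registered stubs (open) -/

/-- GCW — the plaquette grand-canonical window (LANDED, certified computation, μ = U/2, γ = 1/20;
p156227). [cite: TsaiKivelson2006, Table I] -/
theorem plaquetteGCWindow :
    ∀ U ∈ Set.Icc (2 : ℝ) 4, ∃ μ γ : ℝ, 0 < γ ∧
      ∀ v : Fock (Orb (FermionTorus 2 2)),
        (∀ w ∈ (szSector 4 0 : Submodule ℂ (Fock (Orb (FermionTorus 2 2)))),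
          hubbardTorus 2 2 1 U *ᵥ w = (((hubbardTorus 2 2 1 U).minEnergyOn (szSector 4 0) : ℝ) : ℂ) • w →
            star w ⬝ᵥ v = 0) →
        ((hubbardTorus 2 2 1 U).minEnergyOn (szSector 4 0) - 4 * μ + γ) * (star v ⬝ᵥ v).re ≤
          (star v ⬝ᵥ ((hubbardTorus 2 2 1 U - (μ : ℂ) • totalNumber) *ᵥ v)).re :=
  Summit.HubbardSuperconductivity.HubbardSuperconductivity.Theorems.CooperPairDMottWalk.stub_plaquetteGCWindow

/-- **Stub RB — relative-bound gap stability of the d-Mott parent (THE engine of H; lead, reshape 4).**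
For every `U ∈ [2,4]` there are `c, b₀ > 0` such that for `b ∈ (0, b₀)` and `k ≥ k₀(b)` some
number-conserving isometry `V` of the Fock space of the breathing torus `H_L(1,b,U)`, `L = 4k+4`
(the inverse spectral flow / Lie–Schwinger conjugation) satisfies, for EVERY state `φ`, at `μ = U/2`:
`(1 − c b)·[Re⟨Vφ, (H_intra − μN)Vφ⟩ − (L/2)²(e₄ − 4μ)‖φ‖²] − b‖φ‖² ≤ Re⟨φ, (H_L − μN)φ⟩ − (E(L²,0) − μL²)‖φ‖²`
— the grand-canonical excitation energy of the coupled torus above its half-filled ground level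
dominates `(1 − O(b))` times the excitation energy of the DECOUPLED plaquettes (Bravyi–Hastings–
Michalakis relative boundedness; Michalakis–Zwolak; Del Vecchio–Fröhlich–Pizzo–Rossi block
diagonalisation; fermionic quasi-locality of Nachtergaele–Sims–Young). No printed theorem states this
for interacting FERMIONIC block parents: this is the open engine shared with U″ (E1). The additive
slack `b‖φ‖²` absorbs finite-size tails. [cite: MichalakisZwolakCMP2013, Thm. 1]
[cite: arXiv:1705.08553, §6] -/
theorem stub_relativeBoundDMott :
    (let Hb := fun (L : ℕ) (a b U : ℝ) => hamiltonian (fermionTorusGraph 2 L \ (⊤ : SimpleGraph (Fin 2 → ℕ)).comap (fun (x : FermionTorus 2 L) (i : Fin 2) => (ofLex x i : ℕ) / 2)) a U + hamiltonian (fermionTorusGraph 2 L ⊓ (⊤ : SimpleGraph (Fin 2 → ℕ)).comap (fun (x : FermionTorus 2 L) (i : Fin 2) => (ofLex x i : ℕ) / 2)) b 0;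
    ∀ U ∈ Set.Icc (2 : ℝ) 4, ∃ c > (0 : ℝ), ∃ b₀ > (0 : ℝ), ∀ b ∈ Set.Ioo 0 b₀, ∃ k₀ : ℕ, ∀ k ≥ k₀,
      ∃ V : Matrix (Finset (Orb (FermionTorus 2 (4 * k + 4)))) (Finset (Orb (FermionTorus 2 (4 * k + 4)))) ℂ,
        Commute V totalNumber ∧ (∀ φ, star (V *ᵥ φ) ⬝ᵥ (V *ᵥ φ) = star φ ⬝ᵥ φ) ∧
        ∀ φ : Fock (Orb (FermionTorus 2 (4 * k + 4))),
          (1 - c * b) * ((star (V *ᵥ φ) ⬝ᵥ ((hamiltonian (fermionTorusGraph 2 (4 * k + 4) \ (⊤ : SimpleGraph (Fin 2 → ℕ)).comap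
                (fun (x : FermionTorus 2 (4 * k + 4)) (i : Fin 2) => (ofLex x i : ℕ) / 2)) 1 U
                - ((U / 2 : ℝ) : ℂ) • totalNumber) *ᵥ (V *ᵥ φ))).re
              - ((((4 * k + 4) / 2) ^ 2 : ℕ) : ℝ) * ((hubbardTorus 2 2 1 U).minEnergyOn (szSector 4 0) - 2 * U) *
                (star φ ⬝ᵥ φ).re)
            - b * (star φ ⬝ᵥ φ).re ≤
          (star φ ⬝ᵥ ((Hb (4 * k + 4) 1 b U - ((U / 2 : ℝ) : ℂ) • totalNumber) *ᵥ φ)).re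
            - ((Hb (4 * k + 4) 1 b U).minEnergyOn (szSector ((4 * k + 4) ^ 2) 0)
                - U / 2 * (((4 * k + 4) ^ 2 : ℕ) : ℝ)) * (star φ ⬝ᵥ φ).re) := by
  sorry

/-- OF — the odd-sector floor of the plaquette at μ = U/2 (LANDED, p159090: GC-window certificates + spin-swap and
particle–hole transport of sector bounds). [cite: TsaiKivelson2006, Table I] -/
theorem plaquetteOddSectorFloor :
    ∀ U ∈ Set.Icc (2 : ℝ) 4,
      (∀ a b : ℕ, ∀ v : Fock (Orb (FermionTorus 2 2)), IsInSector a b v →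
        ((hubbardTorus 2 2 1 U).minEnergyOn (szSector 4 0) - 2 * U) * (star v ⬝ᵥ v).re ≤
          (star v ⬝ᵥ ((hubbardTorus 2 2 1 U - ((U / 2 : ℝ) : ℂ) • totalNumber) *ᵥ v)).re) ∧
      (∀ a b : ℕ, ¬ Even (a + b) → ∀ v : Fock (Orb (FermionTorus 2 2)), IsInSector a b v →
        ((hubbardTorus 2 2 1 U).minEnergyOn (szSector 3 (1 / 2)) - 3 * (U / 2)) * (star v ⬝ᵥ v).re ≤
          (star v ⬝ᵥ ((hubbardTorus 2 2 1 U - ((U / 2 : ℝ) : ℂ) • totalNumber) *ᵥ v)).re) ∧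
      (hubbardTorus 2 2 1 U).minEnergyOn (szSector 4 0) - U / 2 <
        (hubbardTorus 2 2 1 U).minEnergyOn (szSector 3 (1 / 2)) :=
  Summit.HubbardSuperconductivity.HubbardSuperconductivity.Theorems.CooperPairDMottWalk.stub_plaquetteOddSectorFloor

/-- H — the holon floor from RB and OF (landed glue `holonBandFloor_of_relativeBound`, p157906, and the
parity bookkeeping `…HolonBandFloorParity`, p157664). [folklore] -/
theorem holonBandFloor :
    (let Hb := fun (L : ℕ) (a b U : ℝ) => hamiltonian (fermionTorusGraph 2 L \ (⊤ : SimpleGraph (Fin 2 → ℕ)).comap (fun (x : FermionTorus 2 L) (i : Fin 2) => (ofLex x i : ℕ) / 2)) a U + hamiltonian (fermionTorusGraph 2 L ⊓ (⊤ : SimpleGraph (Fin 2 → ℕ)).comap (fun (x : FermionTorus 2 L) (i : Fin 2) => (ofLex x i : ℕ) / 2)) b 0;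
    ∀ U ∈ Set.Icc (2 : ℝ) 4, ∃ C > (0 : ℝ), ∃ b₀ > (0 : ℝ), ∀ b ∈ Set.Ioo 0 b₀, ∃ k₀ : ℕ, ∀ k ≥ k₀,
      (Hb (4 * k + 4) 1 b U).minEnergyOn (szSector ((4 * k + 4) ^ 2) 0) +
          ((hubbardTorus 2 2 1 U).minEnergyOn (szSector 3 (1 / 2)) -
            (hubbardTorus 2 2 1 U).minEnergyOn (szSector 4 0)) - C * b ≤
        (Hb (4 * k + 4) 1 b U).minEnergyOn (szSector ((4 * k + 4) ^ 2 - 1) (1 / 2))) :=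
  Summit.HubbardSuperconductivity.HubbardSuperconductivity.Theorems.CooperPairDMottWalk.holonBandFloor_of_relativeBound
    stub_relativeBoundDMott plaquetteOddSectorFloor


/-- **Stub U″ — the pair band in per-momentum Schur form (clause (b) reduced by Feshbach–Schur and
plaquette-momentum blocks; wave 2).** For every `U ∈ [2,4]`, small `b` and large `L = 4k+4` there are a
sector vector `Ψ₀`, its plaquette-momentum components `p K = Σ_m conj χ_K(m) U_{2m} Ψ₀`, a bottom
momentum `K₀`, a level `E₁` and gaps `g K > 0` such that: (E0) the Rayleigh quotient of `p K₀` is `< E₁`;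
(E1, two-holon threshold per momentum) in each momentum-`K` block, orthogonally to `p K`, the form of
`Hb` is `≥ E₁ + g K`; (E2, pair-band dispersion with leakage absorbed) for `K ≠ K₀` the energy variance
of `p K` is `≤ (⟨H⟩_{pK} − E₁)·g K`. Lossless (with `Ψ₀ := Σ_K φ_K` the exact block bottoms E1 ⟺
λ₂(K₀-block) > λ₁(K₀), E2 ⟺ λ₁(K) > λ₁(K₀)); gives `stub_twoHoleGapOrthogonal` verbatim by
`twoHoleGapOrthogonal_of_pairBandSchur` (p156161). Engines: λ₂ − λ₁ ≥ Δ_p − Cb in the K₀ block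
(relative-bound stability, shared with H) and λ₁(K) − λ₁(K₀) ≥ (c b² − C b⁴)·dist(K,K₀)² (flat-band
second-order perturbation theory with locality). [cite: YaoTsaiKivelson2007, eq. (2)]
[cite: doi:10.1007/s00220-013-1688-z] -/
theorem stub_pairBandSchur :
    (let Hb := fun (L : ℕ) (a b U : ℝ) => hamiltonian (fermionTorusGraph 2 L \ (⊤ : SimpleGraph (Fin 2 → ℕ)).comap (fun (x : FermionTorus 2 L) (i : Fin 2) => (ofLex x i : ℕ) / 2)) a U + hamiltonian (fermionTorusGraph 2 L ⊓ (⊤ : SimpleGraph (Fin 2 → ℕ)).comap (fun (x : FermionTorus 2 L) (i : Fin 2) => (ofLex x i : ℕ) / 2)) b 0; ∀ U ∈ Set.Icc (2 : ℝ) 4, ∃ b₀ > (0 : ℝ), ∀ b ∈ Set.Ioo 0 b₀, ∃ k₀ : ℕ, ∀ k ≥ k₀, ∃ (Ψ₀ : Fock (Orb (FermionTorus 2 (4 * k + 4)))) (p : Literature.Probability.LatticeModels.TorusSite 2 (4 * k + 4) → Fock (Orb (FermionTorus 2 (4 * k + 4)))) (K₀ : Literature.Probability.LatticeModels.TorusSite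 2 (4 * k + 4)) (E₁ : ℝ) (g : Literature.Probability.LatticeModels.TorusSite 2 (4 * k + 4) → ℝ), Ψ₀ ∈ szSector ((4 * k + 4) ^ 2 - 2) 0 ∧ (∀ K, p K = ∑ m, starRingEnd ℂ (Literature.Probability.LatticeModels.torusChar K m) • ((fockTranslate ((2 : ℕ) • m)).val *ᵥ Ψ₀)) ∧ (∀ K, 0 < g K) ∧ (star (p K₀) ⬝ᵥ (Hb (4 * k + 4) 1 b U) *ᵥ p K₀).re < E₁ * (star (p K₀) ⬝ᵥ p K₀).re ∧ (∀ K, ∀ ψ ∈ szSector ((4 * k + 4) ^ 2 - 2) 0, (∀ w, (fockTranslate ((2 : ℕ) • w)).val *ᵥ ψ = Literature.Probability.LatticeModels.torusChar K w • ψ) → star (p K) ⬝ᵥ ψ = 0 → (E₁ + g K) * (star ψ ⬝ᵥ ψ).re ≤ (star ψ ⬝ᵥ (Hb (4 * k + 4) 1 b U) *ᵥ ψ).re) ∧ (∀ K, K ≠ K₀ → (star ((Hb (4 * k + 4) 1 b U) *ᵥ p K) ⬝ᵥ ((Hb (4 * k + 4) 1 b U) *ᵥ p K)).re * (star (p K)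 ⬝ᵥ p K).re - (star (p K) ⬝ᵥ (Hb (4 * k + 4) 1 b U) *ᵥ p K).re ^ 2 ≤ ((star (p K) ⬝ᵥ (Hb (4 * k + 4) 1 b U) *ᵥ p K).re - E₁ * (star (p K) ⬝ᵥ p K).re) * g K * (star (p K) ⬝ᵥ p K).re)) := by
  sorry

/-- U′ — two-hole spectral isolation from the per-momentum Schur data (landed reduction p156161 + stub U″).
[folklore] -/
theorem twoHoleGapOrthogonal :
    (let Hb := fun (L : ℕ) (a b U : ℝ) => hamiltonian (fermionTorusGraph 2 L \ (⊤ : SimpleGraph (Fin 2 → ℕ)).comap (fun (x : FermionTorus 2 L) (i : Fin 2) => (ofLex x i : ℕ) / 2)) a U + hamiltonian (fermionTorusGraph 2 L ⊓ (⊤ : SimpleGraph (Fin 2 → ℕ)).comap (fun (x : FermionTorus 2 L) (i : Fin 2) => (ofLex x i : ℕ) / 2)) b 0; ∀ U ∈ Set.Icc (2 : ℝ) 4, ∃ b₀ > (0 : ℝ), ∀ b ∈ Set.Ioo 0 b₀, ∃ k₀ : ℕ, ∀ k ≥ k₀, ∃ (Ω : Fock (Orb (FermionTorus 2 (4 * k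 + 4)))) (E₁ : ℝ), (Hb (4 * k + 4) 1 b U).minEnergyOn (szSector ((4 * k + 4) ^ 2 - 2) 0) < E₁ ∧ ∀ ψ ∈ szSector ((4 * k + 4) ^ 2 - 2) 0, star Ω ⬝ᵥ ψ = 0 → E₁ * (star ψ ⬝ᵥ ψ).re ≤ (star ψ ⬝ᵥ (Hb (4 * k + 4) 1 b U) *ᵥ ψ).re) :=
  Summit.HubbardSuperconductivity.HubbardSuperconductivity.Theorems.CooperPairDMottWalk.twoHoleGapOrthogonal_of_pairBandSchur stub_pairBandSchur

/-- D′a — unique `(2,0)` plaquette ground state and nonzero `d`-wave matrix element (LANDED, certified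
computation, p156482). [cite: doi:10.1080/01418639608240361] -/
theorem plaquetteDWaveElement :
    ∀ U ∈ Set.Icc (2 : ℝ) 4,
      (∀ φ₁ φ₂, IsGroundStateInSector (hubbardTorus 2 2 1 U) 2 0 φ₁ →
        IsGroundStateInSector (hubbardTorus 2 2 1 U) 2 0 φ₂ → ∃ c : ℂ, φ₂ = c • φ₁) ∧
      (∀ φ₂ φ₄, IsGroundStateInSector (hubbardTorus 2 2 1 U) 2 0 φ₂ →
        IsGroundStateInSector (hubbardTorus 2 2 1 U) 4 0 φ₄ →
          star φ₂ ⬝ᵥ (pairField dWaveFormFactor 2 *ᵥ φ₄) ≠ 0) :=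
  Summit.HubbardSuperconductivity.HubbardSuperconductivity.Theorems.CooperPairDMottWalk.stub_plaquetteDWaveElement

/-- **Stub S1 — flat-band structure of the two-hole ground state (wave 2).** For every `U ∈ [2,4]`
there is `c₁ > 0` such that for small `b` and large `L = 4k+4`, if the two-hole ground state `φ₂` is
unique then it has overlap fraction `≥ c₁` (relative to the diagonal Gram sum) with the K = 0
superposition `Σ_c A_c Ω` of the dressed one-plaquette pairs, `A_c = jwEmbed_c (|π⟩⟨σ|)`, `Ω` the
parent ground state: φ₂ IS the dressed zero-momentum bottom of the pair band. Engine-level (in-band gap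
O(b²/L²) defeats global arguments). [cite: YaoTsaiKivelson2007] -/
theorem stub_pairOverlapStructure :
    (let Hb := fun (L : ℕ) (a b U : ℝ) => hamiltonian (fermionTorusGraph 2 L \ (⊤ : SimpleGraph (Fin 2 → ℕ)).comap (fun (x : FermionTorus 2 L) (i : Fin 2) => (ofLex x i : ℕ) / 2)) a U + hamiltonian (fermionTorusGraph 2 L ⊓ (⊤ : SimpleGraph (Fin 2 → ℕ)).comap (fun (x : FermionTorus 2 L) (i : Fin 2) => (ofLex x i : ℕ) / 2)) b 0;
      ∀ U ∈ Set.Icc (2 : ℝ) 4, ∃ c₁ > (0 : ℝ), ∃ b₁ > (0 : ℝ), ∀ b ∈ Set.Ioo 0 b₁, ∃ k₀ : ℕ, ∀ k ≥ k₀,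
        (∀ φ₁ φ₂, IsGroundStateInSector (Hb (4 * k + 4) 1 b U) ((4 * k + 4) ^ 2 - 2) 0 φ₁ →
          IsGroundStateInSector (Hb (4 * k + 4) 1 b U) ((4 * k + 4) ^ 2 - 2) 0 φ₂ → ∃ c : ℂ, φ₂ = c • φ₁) →
        ∀ (f : ℕ × ℕ → (FermionTorus 2 2 ↪o FermionTorus 2 (4 * k + 4))),
          (∀ c ∈ Finset.range ((4 * k + 4) / 2) ×ˢ Finset.range ((4 * k + 4) / 2), ∀ X j,
            (ofLex (f c X) j : ℕ) = ![c.1 * 2, c.2 * 2] j + (ofLex X j : ℕ)) →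
        ∀ (π σ : Fock (Orb (FermionTorus 2 2))), star π ⬝ᵥ π = 1 →
          IsGroundStateInSector (hubbardTorus 2 2 1 U) 2 0 π → star σ ⬝ᵥ σ = 1 →
          IsGroundStateInSector (hubbardTorus 2 2 1 U) 4 0 σ →
        ∀ (Ω φ₂ : Fock (Orb (FermionTorus 2 (4 * k + 4)))),
          IsGroundStateInSector (Hb (4 * k + 4) 1 b U) ((4 * k + 4) ^ 2) 0 Ω →
          IsGroundStateInSector (Hb (4 * k + 4) 1 b U) ((4 * k + 4) ^ 2 - 2) 0 φ₂ →
        c₁ * (star φ₂ ⬝ᵥ φ₂).re *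
            ∑ c ∈ Finset.range ((4 * k + 4) / 2) ×ˢ Finset.range ((4 * k + 4) / 2),
              (star (jwEmbed (orbEmb (f c)) (Matrix.vecMulVec π (star σ)) *ᵥ Ω) ⬝ᵥ
                (jwEmbed (orbEmb (f c)) (Matrix.vecMulVec π (star σ)) *ᵥ Ω)).re ≤
          ‖star φ₂ ⬝ᵥ ((∑ c ∈ Finset.range ((4 * k + 4) / 2) ×ˢ Finset.range ((4 * k + 4) / 2),
            jwEmbed (orbEmb (f c)) (Matrix.vecMulVec π (star σ))) *ᵥ Ω)‖ ^ 2) := by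
  sorry

/-- **Stub S3 — locality of the dressed remainder (wave 2).** With the same data there is `C` such
that `|⟨φ₂, Δ_d Ω⟩ − (m/2)⟨φ₂, Σ_c A_c Ω⟩| ≤ C b L ‖φ₂‖‖Ω‖`, `m = ⟨π, Δ_d^{plaq} σ⟩` (the exact split
`Δ_d(L) = ½ Σ_c jwEmbed_c(Δ_d^{plaq}) + inter-plaquette bonds` is `pairField_dWave_eq_sum_jwEmbed_add_inter`,
p155808; both remainders vanish identically at b = 0). Needs local control of both dressed ground states
(clustering / local perturbations perturb locally); engine-level. [cite: Scalapino1995, §2] -/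
theorem stub_pairRemainderLocality :
    (let Hb := fun (L : ℕ) (a b U : ℝ) => hamiltonian (fermionTorusGraph 2 L \ (⊤ : SimpleGraph (Fin 2 → ℕ)).comap (fun (x : FermionTorus 2 L) (i : Fin 2) => (ofLex x i : ℕ) / 2)) a U + hamiltonian (fermionTorusGraph 2 L ⊓ (⊤ : SimpleGraph (Fin 2 → ℕ)).comap (fun (x : FermionTorus 2 L) (i : Fin 2) => (ofLex x i : ℕ) / 2)) b 0;
      ∀ U ∈ Set.Icc (2 : ℝ) 4, ∃ C : ℝ, ∃ b₁ > (0 : ℝ), ∀ b ∈ Set.Ioo 0 b₁, ∃ k₀ : ℕ, ∀ k ≥ k₀,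
        (∀ φ₁ φ₂, IsGroundStateInSector (Hb (4 * k + 4) 1 b U) ((4 * k + 4) ^ 2 - 2) 0 φ₁ →
          IsGroundStateInSector (Hb (4 * k + 4) 1 b U) ((4 * k + 4) ^ 2 - 2) 0 φ₂ → ∃ c : ℂ, φ₂ = c • φ₁) →
        ∀ (f : ℕ × ℕ → (FermionTorus 2 2 ↪o FermionTorus 2 (4 * k + 4))),
          (∀ c ∈ Finset.range ((4 * k + 4) / 2) ×ˢ Finset.range ((4 * k + 4) / 2), ∀ X j,
            (ofLex (f c X) j : ℕ) = ![c.1 * 2, c.2 * 2] j + (ofLex X j : ℕ)) →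
        ∀ (π σ : Fock (Orb (FermionTorus 2 2))), star π ⬝ᵥ π = 1 →
          IsGroundStateInSector (hubbardTorus 2 2 1 U) 2 0 π → star σ ⬝ᵥ σ = 1 →
          IsGroundStateInSector (hubbardTorus 2 2 1 U) 4 0 σ →
        ∀ (Ω φ₂ : Fock (Orb (FermionTorus 2 (4 * k + 4)))),
          IsGroundStateInSector (Hb (4 * k + 4) 1 b U) ((4 * k + 4) ^ 2) 0 Ω →
          IsGroundStateInSector (Hb (4 * k + 4) 1 b U) ((4 * k + 4) ^ 2 - 2) 0 φ₂ →
        ‖star φ₂ ⬝ᵥ (pairField dWaveFormFactor (4 * k + 4) *ᵥ Ω) -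
            (star π ⬝ᵥ (pairField dWaveFormFactor 2 *ᵥ σ)) / 2 *
              (star φ₂ ⬝ᵥ ((∑ c ∈ Finset.range ((4 * k + 4) / 2) ×ˢ Finset.range ((4 * k + 4) / 2),
                jwEmbed (orbEmb (f c)) (Matrix.vecMulVec π (star σ))) *ᵥ Ω))‖ ^ 2 ≤
          (C * b) ^ 2 * ((4 * k + 4 : ℕ) : ℝ) ^ 2 * (star φ₂ ⬝ᵥ φ₂).re * (star Ω ⬝ᵥ Ω).re) := by
  sorry

/-- D′b — the structural part of D′ from S1 and S3 (landed reduction `dWaveResidueStructural_of_pairStructure`,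
p155593; z = |m|² c₁ / 128). [folklore] -/
theorem dWaveResidueStructural :
    (∀ U ∈ Set.Icc (2 : ℝ) 4,
      (∀ φ₁ φ₂, IsGroundStateInSector (hubbardTorus 2 2 1 U) 2 0 φ₁ →
        IsGroundStateInSector (hubbardTorus 2 2 1 U) 2 0 φ₂ → ∃ c : ℂ, φ₂ = c • φ₁) ∧
      (∀ φ₂ φ₄, IsGroundStateInSector (hubbardTorus 2 2 1 U) 2 0 φ₂ →
        IsGroundStateInSector (hubbardTorus 2 2 1 U) 4 0 φ₄ →
          star φ₂ ⬝ᵥ (pairField dWaveFormFactor 2 *ᵥ φ₄) ≠ 0)) →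
    (∀ U ∈ Set.Icc (2 : ℝ) 4, ∃ μ γ : ℝ, 0 < γ ∧
      ∀ v : Fock (Orb (FermionTorus 2 2)),
        (∀ w ∈ (szSector 4 0 : Submodule ℂ (Fock (Orb (FermionTorus 2 2)))),
          hubbardTorus 2 2 1 U *ᵥ w = (((hubbardTorus 2 2 1 U).minEnergyOn (szSector 4 0) : ℝ) : ℂ) • w →
            star w ⬝ᵥ v = 0) →
        ((hubbardTorus 2 2 1 U).minEnergyOn (szSector 4 0) - 4 * μ + γ) * (star v ⬝ᵥ v).re ≤
          (star v ⬝ᵥ ((hubbardTorus 2 2 1 U - (μ : ℂ) • totalNumber) *ᵥ v)).re) →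
    (let Hb := fun (L : ℕ) (a b U : ℝ) => hamiltonian (fermionTorusGraph 2 L \ (⊤ : SimpleGraph (Fin 2 → ℕ)).comap (fun (x : FermionTorus 2 L) (i : Fin 2) => (ofLex x i : ℕ) / 2)) a U + hamiltonian (fermionTorusGraph 2 L ⊓ (⊤ : SimpleGraph (Fin 2 → ℕ)).comap (fun (x : FermionTorus 2 L) (i : Fin 2) => (ofLex x i : ℕ) / 2)) b 0; ∀ U ∈ Set.Icc (2 : ℝ) 4, ∃ b₀ > (0 : ℝ), ∀ b ∈ Set.Ioo 0 b₀, ∃ z > (0 : ℝ), ∃ k₀ : ℕ, ∀ k ≥ k₀, (∀ φ₁ φ₂, IsGroundStateInSector (Hb (4 * k + 4) 1 b U) ((4 * k + 4) ^ 2 - 2) 0 φ₁ → IsGroundStateInSector (Hb (4 * k + 4) 1 b U) ((4 * k + 4) ^ 2 - 2) 0 φ₂ → ∃ c : ℂ, φ₂ = c • φ₁) → ∃ φ₀ φ₂, IsGroundStateInSector (Hb (4 * k + 4) 1 b U) ((4 * k + 4) ^ 2) 0 φ₀ ∧ IsGroundStateInSector (Hb (4 * k + 4) 1 b U) ((4 *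 k + 4) ^ 2 - 2) 0 φ₂ ∧ z * ((4 * k + 4 : ℕ) : ℝ) ^ 2 * (star φ₀ ⬝ᵥ φ₀).re * (star φ₂ ⬝ᵥ φ₂).re ≤ ‖star φ₂ ⬝ᵥ (pairField dWaveFormFactor (4 * k + 4) *ᵥ φ₀)‖ ^ 2) := by
  intro hDa hGC
  have h := Summit.HubbardSuperconductivity.HubbardSuperconductivity.Theorems.CooperPairDMottWalk.dWaveResidueStructural_of_pairStructure
    hDa hGC stub_pairOverlapStructure stub_pairRemainderLocality
  dsimp only at h ⊢
  exact h


/-! ## Stubs already discharged (sorry-free, imported) -/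

/-- Δ — plaquette pair binding on `[2,4]` (landed, certified computation, p150817). [cite: TsaiKivelson2006] -/
theorem plaquettePairBinding :
    ∀ U ∈ Set.Icc (2 : ℝ) 4,
      (hubbardTorus 2 2 1 U).minEnergyOn (szSector 2 0) +
          (hubbardTorus 2 2 1 U).minEnergyOn (szSector 4 0) <
        2 * (hubbardTorus 2 2 1 U).minEnergyOn (szSector 3 (1 / 2)) :=
  Summit.HubbardSuperconductivity.HubbardSuperconductivity.Theorems.CooperPairDMottWalk.stub_plaquettePairBinding

/-- P — the pair ceiling from the GC window (landed reduction p152016 + stub GCW). [folklore] -/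
theorem pairTrialCeiling :
    (let Hb := fun (L : ℕ) (a b U : ℝ) => hamiltonian (fermionTorusGraph 2 L \ (⊤ : SimpleGraph (Fin 2 → ℕ)).comap (fun (x : FermionTorus 2 L) (i : Fin 2) => (ofLex x i : ℕ) / 2)) a U + hamiltonian (fermionTorusGraph 2 L ⊓ (⊤ : SimpleGraph (Fin 2 → ℕ)).comap (fun (x : FermionTorus 2 L) (i : Fin 2) => (ofLex x i : ℕ) / 2)) b 0;
    ∀ U ∈ Set.Icc (2 : ℝ) 4, ∃ C > (0 : ℝ), ∃ b₀ > (0 : ℝ), ∀ b ∈ Set.Ioo 0 b₀, ∃ k₀ : ℕ, ∀ k ≥ k₀,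
      (Hb (4 * k + 4) 1 b U).minEnergyOn (szSector ((4 * k + 4) ^ 2 - 2) 0) ≤
        (Hb (4 * k + 4) 1 b U).minEnergyOn (szSector ((4 * k + 4) ^ 2) 0) +
          ((hubbardTorus 2 2 1 U).minEnergyOn (szSector 2 0) -
            (hubbardTorus 2 2 1 U).minEnergyOn (szSector 4 0)) + C * b) :=
  Summit.HubbardSuperconductivity.HubbardSuperconductivity.Theorems.CooperPairDMottWalk.pairTrialCeiling_of_plaquetteGCWindow
    plaquetteGCWindow

/-- U — clause (b) from the spectral form (landed reduction p149865 + stub U′). [folklore] -/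
theorem uniqueTwoHoleGroundState :
    (let Hb := fun (L : ℕ) (a b U : ℝ) => hamiltonian (fermionTorusGraph 2 L \ (⊤ : SimpleGraph (Fin 2 → ℕ)).comap (fun (x : FermionTorus 2 L) (i : Fin 2) => (ofLex x i : ℕ) / 2)) a U + hamiltonian (fermionTorusGraph 2 L ⊓ (⊤ : SimpleGraph (Fin 2 → ℕ)).comap (fun (x : FermionTorus 2 L) (i : Fin 2) => (ofLex x i : ℕ) / 2)) b 0;
    ∀ U ∈ Set.Icc (2 : ℝ) 4, ∃ b₀ > (0 : ℝ), ∀ b ∈ Set.Ioo 0 b₀, ∃ k₀ : ℕ, ∀ k ≥ k₀,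
      ∀ φ₁ φ₂, IsGroundStateInSector (Hb (4 * k + 4) 1 b U) ((4 * k + 4) ^ 2 - 2) 0 φ₁ →
        IsGroundStateInSector (Hb (4 * k + 4) 1 b U) ((4 * k + 4) ^ 2 - 2) 0 φ₂ → ∃ c : ℂ, φ₂ = c • φ₁) :=
  Summit.HubbardSuperconductivity.HubbardSuperconductivity.Theorems.CooperPairDMottWalk.uniqueTwoHoleGroundState_of_gap_orthogonal
    twoHoleGapOrthogonal

/-- D′ — one good pair of ground states, from the structural stub D′b fed with D′a and GCW. [folklore] -/
theorem dWaveResidueExists :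
    (let Hb := fun (L : ℕ) (a b U : ℝ) => hamiltonian (fermionTorusGraph 2 L \ (⊤ : SimpleGraph (Fin 2 → ℕ)).comap (fun (x : FermionTorus 2 L) (i : Fin 2) => (ofLex x i : ℕ) / 2)) a U + hamiltonian (fermionTorusGraph 2 L ⊓ (⊤ : SimpleGraph (Fin 2 → ℕ)).comap (fun (x : FermionTorus 2 L) (i : Fin 2) => (ofLex x i : ℕ) / 2)) b 0; ∀ U ∈ Set.Icc (2 : ℝ) 4, ∃ b₀ > (0 : ℝ), ∀ b ∈ Set.Ioo 0 b₀, ∃ z > (0 : ℝ), ∃ k₀ : ℕ, ∀ k ≥ k₀, (∀ φ₁ φ₂, IsGroundStateInSector (Hb (4 * k + 4) 1 b U) ((4 * k + 4) ^ 2 - 2) 0 φ₁ → IsGroundStateInSector (Hb (4 * k + 4) 1 b U) ((4 * k + 4) ^ 2 - 2) 0 φ₂ → ∃ c : ℂ, φ₂ = c • φ₁) → ∃ φ₀ φ₂, IsGroundStateInSector (Hb (4 * k + 4) 1 b U) ((4 * k + 4) ^ 2) 0 φ₀ ∧ IsGroundStateInSector (Hb (4 * k + 4) 1 b U) ((4 *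 k + 4) ^ 2 - 2) 0 φ₂ ∧ z * ((4 * k + 4 : ℕ) : ℝ) ^ 2 * (star φ₀ ⬝ᵥ φ₀).re * (star φ₂ ⬝ᵥ φ₂).re ≤ ‖star φ₂ ⬝ᵥ (pairField dWaveFormFactor (4 * k + 4) *ᵥ φ₀)‖ ^ 2) :=
  dWaveResidueStructural plaquetteDWaveElement plaquetteGCWindow

/-- D — clause (c) given (b) from one good pair (landed reduction p152712 + stub D′). [cite: LiebPRL1989, Theorem 2] -/
theorem dWaveResidueOfUniquePair :
    (let Hb := fun (L : ℕ) (a b U : ℝ) => hamiltonian (fermionTorusGraph 2 L \ (⊤ : SimpleGraph (Fin 2 → ℕ)).comap (fun (x : FermionTorus 2 L) (i : Fin 2) => (ofLex x i : ℕ) / 2)) a U + hamiltonian (fermionTorusGraph 2 L ⊓ (⊤ : SimpleGraph (Fin 2 → ℕ)).comap (fun (x : FermionTorus 2 L) (i : Fin 2) => (ofLex x i : ℕ) / 2)) b 0;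
    ∀ U ∈ Set.Icc (2 : ℝ) 4, ∃ b₀ > (0 : ℝ), ∀ b ∈ Set.Ioo 0 b₀, ∃ z > (0 : ℝ), ∃ k₀ : ℕ, ∀ k ≥ k₀,
      (∀ φ₁ φ₂, IsGroundStateInSector (Hb (4 * k + 4) 1 b U) ((4 * k + 4) ^ 2 - 2) 0 φ₁ →
        IsGroundStateInSector (Hb (4 * k + 4) 1 b U) ((4 * k + 4) ^ 2 - 2) 0 φ₂ → ∃ c : ℂ, φ₂ = c • φ₁) →
      ∀ φ₀ φ₂, IsGroundStateInSector (Hb (4 * k + 4) 1 b U) ((4 * k + 4) ^ 2) 0 φ₀ →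
        IsGroundStateInSector (Hb (4 * k + 4) 1 b U) ((4 * k + 4) ^ 2 - 2) 0 φ₂ →
          z * ((4 * k + 4 : ℕ) : ℝ) ^ 2 * (star φ₀ ⬝ᵥ φ₀).re * (star φ₂ ⬝ᵥ φ₂).re ≤
            ‖star φ₂ ⬝ᵥ (pairField dWaveFormFactor (4 * k + 4) *ᵥ φ₀)‖ ^ 2) :=
  Summit.HubbardSuperconductivity.HubbardSuperconductivity.Theorems.CooperPairDMottWalk.dWaveResidueOfUniquePair_of_exists
    dWaveResidueExists

/-! ## The composition (sorry-free) -/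

/-- **Skeleton theorem: Δ → H → P → U → D → `CooperPairDMott`, concluded BY NAME** (sorry-free).
The mathematics is the threshold bookkeeping of the cluster literature's pair-binding energy,
`2E(L²−1) − E(L²) − E(L²−2) ≥ 2·(holon floor) − (pair ceiling) = Δ_p(U) − (2C_H + C_P)·b`, made
positive by the choice `b₀ ≤ Δ_p(U)/(2C_H + C_P)`; clauses (b), (c) are U and D-fed-with-U at the
common onset `k₀ = max` of the four. [cite: arXiv:0803.0933, eq. (2)] [cite: TsaiKivelson2006] -/
theorem CooperPairDMott_of :
    (∀ U ∈ Set.Icc (2 : ℝ) 4,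
      (hubbardTorus 2 2 1 U).minEnergyOn (szSector 2 0) +
          (hubbardTorus 2 2 1 U).minEnergyOn (szSector 4 0) <
        2 * (hubbardTorus 2 2 1 U).minEnergyOn (szSector 3 (1 / 2))) →
    (let Hb := fun (L : ℕ) (a b U : ℝ) => hamiltonian (fermionTorusGraph 2 L \ (⊤ : SimpleGraph (Fin 2 → ℕ)).comap (fun (x : FermionTorus 2 L) (i : Fin 2) => (ofLex x i : ℕ) / 2)) a U + hamiltonian (fermionTorusGraph 2 L ⊓ (⊤ : SimpleGraph (Fin 2 → ℕ)).comap (fun (x : FermionTorus 2 L) (i : Fin 2) => (ofLex x i : ℕ) / 2)) b 0;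
    ∀ U ∈ Set.Icc (2 : ℝ) 4, ∃ C > (0 : ℝ), ∃ b₀ > (0 : ℝ), ∀ b ∈ Set.Ioo 0 b₀, ∃ k₀ : ℕ, ∀ k ≥ k₀,
      (Hb (4 * k + 4) 1 b U).minEnergyOn (szSector ((4 * k + 4) ^ 2) 0) +
          ((hubbardTorus 2 2 1 U).minEnergyOn (szSector 3 (1 / 2)) -
            (hubbardTorus 2 2 1 U).minEnergyOn (szSector 4 0)) - C * b ≤
        (Hb (4 * k + 4) 1 b U).minEnergyOn (szSector ((4 * k + 4) ^ 2 - 1) (1 / 2))) →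
    (let Hb := fun (L : ℕ) (a b U : ℝ) => hamiltonian (fermionTorusGraph 2 L \ (⊤ : SimpleGraph (Fin 2 → ℕ)).comap (fun (x : FermionTorus 2 L) (i : Fin 2) => (ofLex x i : ℕ) / 2)) a U + hamiltonian (fermionTorusGraph 2 L ⊓ (⊤ : SimpleGraph (Fin 2 → ℕ)).comap (fun (x : FermionTorus 2 L) (i : Fin 2) => (ofLex x i : ℕ) / 2)) b 0;
    ∀ U ∈ Set.Icc (2 : ℝ) 4, ∃ C > (0 : ℝ), ∃ b₀ > (0 : ℝ), ∀ b ∈ Set.Ioo 0 b₀, ∃ k₀ : ℕ, ∀ k ≥ k₀,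
      (Hb (4 * k + 4) 1 b U).minEnergyOn (szSector ((4 * k + 4) ^ 2 - 2) 0) ≤
        (Hb (4 * k + 4) 1 b U).minEnergyOn (szSector ((4 * k + 4) ^ 2) 0) +
          ((hubbardTorus 2 2 1 U).minEnergyOn (szSector 2 0) -
            (hubbardTorus 2 2 1 U).minEnergyOn (szSector 4 0)) + C * b) →
    (let Hb := fun (L : ℕ) (a b U : ℝ) => hamiltonian (fermionTorusGraph 2 L \ (⊤ : SimpleGraph (Fin 2 → ℕ)).comap (fun (x : FermionTorus 2 L) (i : Fin 2) => (ofLex x i : ℕ) / 2)) a U + hamiltonian (fermionTorusGraph 2 L ⊓ (⊤ : SimpleGraph (Fin 2 → ℕ)).comap (fun (x : FermionTorus 2 L) (i : Fin 2) => (ofLex x i : ℕ) / 2)) b 0;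
    ∀ U ∈ Set.Icc (2 : ℝ) 4, ∃ b₀ > (0 : ℝ), ∀ b ∈ Set.Ioo 0 b₀, ∃ k₀ : ℕ, ∀ k ≥ k₀,
      ∀ φ₁ φ₂, IsGroundStateInSector (Hb (4 * k + 4) 1 b U) ((4 * k + 4) ^ 2 - 2) 0 φ₁ →
        IsGroundStateInSector (Hb (4 * k + 4) 1 b U) ((4 * k + 4) ^ 2 - 2) 0 φ₂ → ∃ c : ℂ, φ₂ = c • φ₁) →
    (let Hb := fun (L : ℕ) (a b U : ℝ) => hamiltonian (fermionTorusGraph 2 L \ (⊤ : SimpleGraph (Fin 2 → ℕ)).comap (fun (x : FermionTorus 2 L) (i : Fin 2) => (ofLex x i : ℕ) / 2)) a U + hamiltonian (fermionTorusGraph 2 L ⊓ (⊤ : SimpleGraph (Fin 2 → ℕ)).comap (fun (x : FermionTorus 2 L) (i : Fin 2) => (ofLex x i : ℕ) / 2)) b 0;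
    ∀ U ∈ Set.Icc (2 : ℝ) 4, ∃ b₀ > (0 : ℝ), ∀ b ∈ Set.Ioo 0 b₀, ∃ z > (0 : ℝ), ∃ k₀ : ℕ, ∀ k ≥ k₀,
      (∀ φ₁ φ₂, IsGroundStateInSector (Hb (4 * k + 4) 1 b U) ((4 * k + 4) ^ 2 - 2) 0 φ₁ →
        IsGroundStateInSector (Hb (4 * k + 4) 1 b U) ((4 * k + 4) ^ 2 - 2) 0 φ₂ → ∃ c : ℂ, φ₂ = c • φ₁) →
      ∀ φ₀ φ₂, IsGroundStateInSector (Hb (4 * k + 4) 1 b U) ((4 * k + 4) ^ 2) 0 φ₀ →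
        IsGroundStateInSector (Hb (4 * k + 4) 1 b U) ((4 * k + 4) ^ 2 - 2) 0 φ₂ →
          z * ((4 * k + 4 : ℕ) : ℝ) ^ 2 * (star φ₀ ⬝ᵥ φ₀).re * (star φ₂ ⬝ᵥ φ₂).re ≤
            ‖star φ₂ ⬝ᵥ (pairField dWaveFormFactor (4 * k + 4) *ᵥ φ₀)‖ ^ 2) →
    CooperPairDMott := by
  intro hΔ hH hP hU hD
  dsimp only at hH hP hU hD
  dsimp only [CooperPairDMott]
  intro U hUI
  -- the L-uniform inputs at this U
  obtain ⟨C₂, hC₂, b₂, hb₂, H2⟩ := hH U hUI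
  obtain ⟨C₃, hC₃, b₃, hb₃, H3⟩ := hP U hUI
  obtain ⟨b₄, hb₄, H4⟩ := hU U hUI
  obtain ⟨b₅, hb₅, H5⟩ := hD U hUI
  -- plaquette data: the binding budget Δ_p(U) = 2 e₃ - e₂ - e₄ > 0 must beat (2 C₂ + C₃) b
  have hΔU := hΔ U hUI
  set e2 : ℝ := (hubbardTorus 2 2 1 U).minEnergyOn (szSector 2 0) with he2
  set e3 : ℝ := (hubbardTorus 2 2 1 U).minEnergyOn (szSector 3 (1 / 2)) with he3
  set e4 : ℝ := (hubbardTorus 2 2 1 U).minEnergyOn (szSector 4 0) with he4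
  have hΔpos : 0 < 2 * e3 - e2 - e4 := by linarith
  have hK : 0 < 2 * C₂ + C₃ := by linarith
  have hbstar : 0 < (2 * e3 - e2 - e4) / (2 * C₂ + C₃) := div_pos hΔpos hK
  -- b₀ := min of the four stub thresholds and the budget threshold Δ_p / (2 C₂ + C₃)
  refine ⟨min (min (min b₂ b₃) (min b₄ b₅)) ((2 * e3 - e2 - e4) / (2 * C₂ + C₃)), ?_, ?_⟩
  · exact lt_min (lt_min (lt_min hb₂ hb₃) (lt_min hb₄ hb₅)) hbstar
  intro b hb
  have hb0 : 0 < b := hb.1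
  have hbmin := hb.2
  have hb₂' : b < b₂ := lt_of_lt_of_le hbmin
    (le_trans (min_le_left _ _) (le_trans (min_le_left _ _) (min_le_left _ _)))
  have hb₃' : b < b₃ := lt_of_lt_of_le hbmin
    (le_trans (min_le_left _ _) (le_trans (min_le_left _ _) (min_le_right _ _)))
  have hb₄' : b < b₄ := lt_of_lt_of_le hbmin
    (le_trans (min_le_left _ _) (le_trans (min_le_right _ _) (min_le_left _ _)))
  have hb₅' : b < b₅ := lt_of_lt_of_le hbmin
    (le_trans (min_le_left _ _) (le_trans (min_le_right _ _) (min_le_right _ _)))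
  have hbs' : b < (2 * e3 - e2 - e4) / (2 * C₂ + C₃) := lt_of_lt_of_le hbmin (min_le_right _ _)
  have hbudget : (2 * C₂ + C₃) * b < 2 * e3 - e2 - e4 := by
    have h := (lt_div_iff₀ hK).mp hbs'
    linarith [h]
  obtain ⟨k₂, Hk₂⟩ := H2 b ⟨hb0, hb₂'⟩
  obtain ⟨k₃, Hk₃⟩ := H3 b ⟨hb0, hb₃'⟩
  obtain ⟨k₄, Hk₄⟩ := H4 b ⟨hb0, hb₄'⟩
  obtain ⟨z, hz, k₅, Hk₅⟩ := H5 b ⟨hb0, hb₅'⟩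
  -- ε := Δ_p(U) - (2 C₂ + C₃) b > 0, z from stub D, k₀ := max of the four onsets
  refine ⟨(2 * e3 - e2 - e4) - (2 * C₂ + C₃) * b, by linarith, z, hz,
    max (max k₂ k₃) (max k₄ k₅), ?_⟩
  intro k hk
  have hk₂ : k ≥ k₂ := le_trans (le_trans (le_max_left _ _) (le_max_left _ _)) hk
  have hk₃ : k ≥ k₃ := le_trans (le_trans (le_max_right _ _) (le_max_left _ _)) hk
  have hk₄ : k ≥ k₄ := le_trans (le_trans (le_max_left _ _) (le_max_right _ _)) hk
  have hk₅ : k ≥ k₅ := le_trans (le_trans (le_max_right _ _) (le_max_right _ _)) hk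
  -- clause (a): pair ceiling + twice the holon floor + plaquette binding, pure arithmetic
  have key : ∀ E₀ E₁ E₂ : ℝ, E₀ + (e3 - e4) - C₂ * b ≤ E₁ → E₂ ≤ E₀ + (e2 - e4) + C₃ * b →
      E₂ + E₀ + ((2 * e3 - e2 - e4) - (2 * C₂ + C₃) * b) ≤ 2 * E₁ := by
    intro E₀ E₁ E₂ h₁ h₂
    linarith
  exact ⟨key _ _ _ (Hk₂ k hk₂) (Hk₃ k hk₃), Hk₄ k hk₄, Hk₅ k hk₅ (Hk₄ k hk₄)⟩

/-- **The crux BY NAME from the registered stubs** (hypothesis-free form; its only `sorry`s are the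
four open `stub_*` — GCW, H, U′, D′ — through the landed reductions). [cite: TsaiKivelson2006] -/
theorem CooperPairDMott_of_stubs : CooperPairDMott :=
  CooperPairDMott_of plaquettePairBinding holonBandFloor pairTrialCeiling
    uniqueTwoHoleGroundState dWaveResidueOfUniquePair

end Summit.HubbardSuperconductivity.HubbardSuperconductivity.Cruxes.CooperPairDMott.Birth
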